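import Literature.MathematicalPhysics.QuantumFieldTheory.Balaban1983to89.B12FormatPlus

/-!
# LENS-2 (gen 4) — «ZERO-INPUT SPLIT»: the affine format flow `E ↦ ρ·E + σ` with `σ` NAMED as the format of the
# zero-input one-step output and `ρ < 1` the contraction of the history channel ALONE; kernel glue + separation models
# inside the tree's own mould `B12FormatPlus.FormatPlus`

Unit `ymgap-nodeO-lens-2-g4` (LENS IDEATOR 2, lens (ii) «RG map as a flow on a space of formats — fixed point ∕ contraction»),
crux K0⁷ `stmt-QuantumFields-20541`, target of record stub 2′ `K0V23Defs.stub_absBetaBoxAtThm1WitnessCCMGenGridGZB13` via the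
typer's item 27930‴ (HOME STATUS l.3522: `∃ γ₀ ε₂₉ E₀ κ α₀ α₁, … ∀ k, ∀ v ∈ FlowStep.Box γ₀ k, FP.FormatPlus (record k) (recordΦf F a₀ ε₂₉ k v) E₀ κ`).

WHAT THIS FILE PROVES (kernel, 0 sorry), over ABSTRACT level-indexed record data (every `record…` name of DEF-1 is a variable here):
* §1 `formatPlus_add` ∕ `formatPlus_sub` ∕ `formatPlus_congr` ∕ `formatPlus_of_split`: the mould is closed under pointwise sum and
  difference of functionals with constants adding (pieces add) — the subadditivity the split needs.
* §2 the two PIECES as named predicates — `ZeroInputFormat` (Z: the zero-input functional `Φz k v` has format `σ` at every level, `σ`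
  a NAMED constant, no induction) and `DChannelContraction` (L: for every `E ≤ Ē`, format `E` of ALL previous levels' functionals
  ⟹ format `ρ·E` of the DIFFERENCE `Φ k v − Φz k v`, NO additive slot) — and the GLUE `uniformFormat_of_split`: (Z) ∧ (L) ∧
  `σ ≤ (1 − ρ)·Ē` ⟹ the wall's body `UniformFormat … (σ ∕ (1 − ρ))` (full-memory Grönwall by strong induction); item-shaped
  `wall_of_splitItem` (one shared `∃ σ ρ Ē`, two conjuncts ⟹ `∃ E₀ ≥ 0, UniformFormat … E₀`).
* §3 MODELS INSIDE THE MOULD (one-domain catalogue, constant functionals; `toy_formatPlus_iff : FormatPlus(toy, const c, E₀, κ) ↔ |c| ≤ E₀`):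
  Toy A — the WALL holds (E₀ = 2) and (Z) holds, yet the split item FAILS (`toyA_wall`, `toyA_not_splitItem`): the wall does NOT
  inhabit the split — the exact negation, for THIS typing, of CRIT-1's SAME-WALL kernel for gen 0's free-σ₀ step
  (`Crit1Cut2StepMemWallSketch.fmtStepMem_of_uniform`); Toy B — (L) holds with ρ = 0 while the wall fails (`toyB_contraction`,
  `toyB_not_wall`): (L) is not the wall in costume; Toy B′ — (Z) holds while the wall fails; Toy C — (Z), (L), closure all hold
  NON-VACUOUSLY and the glue fires (`toyC_splitItem`, `toyC_wall`) — rule (N) witness.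

HONEST FRAMING. Bookkeeping over the Literature mould only: nothing of Bałaban's is asserted; `Φ`, `Φz` and all record data are
variables (the record's zero-input functional `recordΦf⁰` is ONE definition owed — DEF-1's lane — see LENS-2-NODE-v4.md §2 (D𝓝⁰));
no estimate of [I]∕[II] is proved or assumed; stub 2′ and K0⁷ stay OPEN; COUNT 8∕28 · K 1∕4 unmoved; finite 𝕋⁴ at fixed ε — NOT
continuum ∕ OS ∕ Clay; the Yang–Mills mass gap is NOT proved by any of this.  No `sorry`, no `instance`, no `notation`, no new axiom.
-/

namespace Summit.QuantumFields.YangMills.Cruxes.Record13SepCoPHInhabited.Lens2G4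

open Literature.MathematicalPhysics.QuantumFieldTheory.Balaban1983to89
open Literature.MathematicalPhysics.QuantumFieldTheory.Balaban1983to89.B12FormatPlus
open _root_.Filter _root_.Topology

noncomputable section

/-! ## §1. Algebra of the mould: pieces add -/

section Algebra

variable {S : ℕ → LocDomainSys} {M m : ℕ → ℕ}
  {Uc : (n : ℕ) → (S n).Dom → Set (Fin (M n) → ℂ)} {coords : (n : ℕ) → (S n).Dom → Finset (Fin (M n))}
  {χ : (n : ℕ) → (S n).Dom → (Fin (m n) → ℂ) → (Fin (M n) → ℂ)} {W : ℕ → Type*} [∀ n, TopologicalSpace (W n)]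
  [∀ n, Zero (W n)] {Φ₁ Φ₂ Φf Ψ : (n : ℕ) → W n → ℂ} {ι : (n : ℕ) → W n → (Fin (m n) → ℂ)}
  {wrap : (n : ℕ) → Finset (S n).Dom} {emb : (n : ℕ) → (S n).Dom → (S (n + 1)).Dom}
  {πc : (n : ℕ) → (S n).Dom → (Fin (M (n + 1)) → ℂ) → (Fin (M n) → ℂ)} {E₁ E₂ E₀ κ : ℝ}

/-- **Pieces add.** The mould is closed under the pointwise sum of two functionals, constants adding, same `κ`. -/
theorem formatPlus_add (h₁ : FormatPlus S M Uc coords m χ Φ₁ ι wrap emb πc E₁ κ)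
    (h₂ : FormatPlus S M Uc coords m χ Φ₂ ι wrap emb πc E₂ κ) :
    FormatPlus S M Uc coords m χ (fun n B => Φ₁ n B + Φ₂ n B) ι wrap emb πc (E₁ + E₂) κ := by
  obtain ⟨P, hA, hB, hL, hR, hV⟩ := h₁
  obtain ⟨Q, hA', hB', hL', hR', hV'⟩ := h₂
  refine ⟨fun n X u => P n X u + Q n X u, ?_, ?_, ?_, ?_, ?_⟩
  · intro n X
    exact (hA n X).add (hA' n X)
  · intro n X u hu
    calc ‖P n X u + Q n X u‖ ≤ ‖P n X u‖ + ‖Q n X u‖ := norm_add_le _ _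
      _ ≤ E₁ * Real.exp (-κ * (S n).dj X) + E₂ * Real.exp (-κ * (S n).dj X) :=
          add_le_add (hB n X u hu) (hB' n X u hu)
      _ = (E₁ + E₂) * Real.exp (-κ * (S n).dj X) := by ring
  · intro n X u u' h
    exact congrArg₂ (· + ·) (hL n X u u' h) (hL' n X u u' h)
  · intro n
    filter_upwards [hR n, hR' n] with B h1 h2
    rw [h1, h2, ← Finset.sum_add_distrib]
  · intro n X hX u'
    exact congrArg₂ (· + ·) (hV n X hX u') (hV' n X hX u')

/-- **Pieces subtract.** -/
theorem formatPlus_sub (h₁ : FormatPlus S M Uc coords m χ Φ₁ ι wrap emb πc E₁ κ)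
    (h₂ : FormatPlus S M Uc coords m χ Φ₂ ι wrap emb πc E₂ κ) :
    FormatPlus S M Uc coords m χ (fun n B => Φ₁ n B - Φ₂ n B) ι wrap emb πc (E₁ + E₂) κ := by
  obtain ⟨P, hA, hB, hL, hR, hV⟩ := h₁
  obtain ⟨Q, hA', hB', hL', hR', hV'⟩ := h₂
  refine ⟨fun n X u => P n X u - Q n X u, ?_, ?_, ?_, ?_, ?_⟩
  · intro n X
    exact (hA n X).sub (hA' n X)
  · intro n X u hu
    calc ‖P n X u - Q n X u‖ ≤ ‖P n X u‖ + ‖Q n X u‖ := norm_sub_le _ _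
      _ ≤ E₁ * Real.exp (-κ * (S n).dj X) + E₂ * Real.exp (-κ * (S n).dj X) :=
          add_le_add (hB n X u hu) (hB' n X u hu)
      _ = (E₁ + E₂) * Real.exp (-κ * (S n).dj X) := by ring
  · intro n X u u' h
    exact congrArg₂ (· - ·) (hL n X u u' h) (hL' n X u u' h)
  · intro n
    filter_upwards [hR n, hR' n] with B h1 h2
    rw [h1, h2, ← Finset.sum_sub_distrib]
  · intro n X hX u'
    exact congrArg₂ (· - ·) (hV n X hX u') (hV' n X hX u')

/-- The mould only reads the germ of the functional at `0`: eventual equality transfers it. -/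
theorem formatPlus_congr (h : FormatPlus S M Uc coords m χ Φf ι wrap emb πc E₀ κ)
    (heq : ∀ n, ∀ᶠ B in 𝓝 (0 : W n), Ψ n B = Φf n B) :
    FormatPlus S M Uc coords m χ Ψ ι wrap emb πc E₀ κ := by
  obtain ⟨P, hA, hB, hL, hR, hV⟩ := h
  refine ⟨P, hA, hB, hL, ?_, hV⟩
  intro n
  filter_upwards [hR n, heq n] with B h1 h2
  rw [h2, h1]

/-- **The split recombined**: format `σ` of `Φz` and format `τ` of `Φ − Φz` give format `σ + τ` of `Φ`. -/
theorem formatPlus_of_split {Φ Φz : (n : ℕ) → W n → ℂ} {σ τ : ℝ}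
    (hZ : FormatPlus S M Uc coords m χ Φz ι wrap emb πc σ κ)
    (hD : FormatPlus S M Uc coords m χ (fun n B => Φ n B - Φz n B) ι wrap emb πc τ κ) :
    FormatPlus S M Uc coords m χ Φ ι wrap emb πc (σ + τ) κ :=
  formatPlus_congr (formatPlus_add hZ hD) fun n => Filter.Eventually.of_forall fun B => by
    show Φ n B = Φz n B + (Φ n B - Φz n B)
    ring

end Algebra

/-! ## §2. The two pieces and the glue (full-memory Grönwall), over abstract level-indexed record data -/

section Glue

variable (S : ℕ → ℕ → LocDomainSys) (M m : ℕ → ℕ → ℕ)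
  (Uc : (k n : ℕ) → (S k n).Dom → Set (Fin (M k n) → ℂ)) (coords : (k n : ℕ) → (S k n).Dom → Finset (Fin (M k n)))
  (χ : (k n : ℕ) → (S k n).Dom → (Fin (m k n) → ℂ) → (Fin (M k n) → ℂ)) (W : ℕ → ℕ → Type*)
  [∀ k n, TopologicalSpace (W k n)] [∀ k n, Zero (W k n)]
  (Φ Φz : (k : ℕ) → (Fin (k + 1) → ℝ) → (n : ℕ) → W k n → ℂ) (ι : (k n : ℕ) → W k n → (Fin (m k n) → ℂ))
  (wrap : (k n : ℕ) → Finset (S k n).Dom) (emb : (k n : ℕ) → (S k n).Dom → (S k (n + 1)).Dom)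
  (πc : (k n : ℕ) → (S k n).Dom → (Fin (M k (n + 1)) → ℂ) → (Fin (M k n) → ℂ))

/-- **THE WALL's body** (27930‴ below its `∃ E₀`): the level-`k` functional `Φ k v` has the format with ONE constant `E₀` at every
level `k` and every admissible history `v ∈ Box γ₀ k`. -/
def UniformFormat (γ₀ E₀ κ : ℝ) : Prop :=
  ∀ k v, v ∈ FlowStep.Box γ₀ k →
    FormatPlus (S k) (M k) (Uc k) (coords k) (m k) (χ k) (Φ k v) (ι k) (wrap k) (emb k) (πc k) E₀ κ

/-- **PIECE (Z) — zero-input format, `σ` NAMED.**  The zero-input functional `Φz k v` (the record's one-step output with the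
accumulated small terms 𝐄_k switched off: history-free) has the format with constant `σ` at every level. -/
def ZeroInputFormat (γ₀ σ κ : ℝ) : Prop :=
  ∀ k v, v ∈ FlowStep.Box γ₀ k →
    FormatPlus (S k) (M k) (Uc k) (coords k) (m k) (χ k) (Φz k v) (ι k) (wrap k) (emb k) (πc k) σ κ

/-- **PIECE (L) — contraction of the history channel, NO additive slot.**  For every format level `0 < E ≤ Ē` (CRIT-1 l.3551 (a):
positive scale, so that the Schwarz radius `Ē′ ∕ E` of §5 is finite; `E = 0` is served separately): if ALL previous levels'
functionals (every admissible history) have format `E`, the DIFFERENCE `Φ k v − Φz k v` has format `ρ·E`. -/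
def DChannelContraction (γ₀ ρ Ē κ : ℝ) : Prop :=
  ∀ k v, v ∈ FlowStep.Box γ₀ k → ∀ E : ℝ, 0 < E → E ≤ Ē →
    (∀ j, j < k → ∀ w, w ∈ FlowStep.Box γ₀ j →
      FormatPlus (S j) (M j) (Uc j) (coords j) (m j) (χ j) (Φ j w) (ι j) (wrap j) (emb j) (πc j) E κ) →
    FormatPlus (S k) (M k) (Uc k) (coords k) (m k) (χ k) (fun n B => Φ k v n B - Φz k v n B) (ι k) (wrap k) (emb k)
      (πc k) (ρ * E) κ

/-- **THE GLUE (full-memory Grönwall).**  (Z) with `σ > 0` (WLOG: the format is monotone in its constant), (L) with `(ρ, Ē)`,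
`0 ≤ ρ < 1` and the closure `σ ≤ (1 − ρ)·Ē` give the wall's body with `E₀ := σ ∕ (1 − ρ) > 0` — by strong induction on the level:
the fixed point of `E ↦ ρ·E + σ` lies in the ball `0 < E ≤ Ē` on which (L) contracts (`0 ≤ ρ` is not needed by the glue; it is
kept as a guard of the ITEM below). -/
theorem uniformFormat_of_split {γ₀ σ ρ Ē κ : ℝ} (hσ : 0 < σ) (hρ1 : ρ < 1) (hcl : σ ≤ (1 - ρ) * Ē)
    (hZ : ZeroInputFormat S M m Uc coords χ W Φz ι wrap emb πc γ₀ σ κ)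
    (hL : DChannelContraction S M m Uc coords χ W Φ Φz ι wrap emb πc γ₀ ρ Ē κ) :
    UniformFormat S M m Uc coords χ W Φ ι wrap emb πc γ₀ (σ / (1 - ρ)) κ := by
  have h1ρ : 0 < 1 - ρ := by linarith
  have hE0 : 0 < σ / (1 - ρ) := div_pos hσ h1ρ
  have hEbar : σ / (1 - ρ) ≤ Ē := by
    rw [div_le_iff₀ h1ρ]
    linarith
  have hne : 1 - ρ ≠ 0 := h1ρ.ne'
  have hconst : σ + ρ * (σ / (1 - ρ)) = σ / (1 - ρ) := by
    field_simp
    ring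
  intro k
  induction k using Nat.strong_induction_on with
  | h k ih =>
    intro v hv
    have hD := hL k v hv (σ / (1 - ρ)) hE0 hEbar (fun j hj w hw => ih j hj w hw)
    have h := formatPlus_of_split (hZ k v hv) hD
    rw [hconst] at h
    exact h

/-- **The split, ITEM-SHAPED**: ONE existential over the shared constants `(σ, ρ, Ē)` with the guards and the closure, two conjuncts. -/
def SplitItem (γ₀ κ : ℝ) : Prop :=
  ∃ σ ρ Ē : ℝ, 0 < σ ∧ 0 ≤ ρ ∧ ρ < 1 ∧ σ ≤ (1 - ρ) * Ē ∧
    ZeroInputFormat S M m Uc coords χ W Φz ι wrap emb πc γ₀ σ κ ∧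
    DChannelContraction S M m Uc coords χ W Φ Φz ι wrap emb πc γ₀ ρ Ē κ

/-- **Split item ⟹ wall item** (`∃ E₀ ≥ 0` above the `∀ k`, the binder order (M′) of the texts of record). -/
theorem wall_of_splitItem {γ₀ κ : ℝ} (h : SplitItem S M m Uc coords χ W Φ Φz ι wrap emb πc γ₀ κ) :
    ∃ E₀ : ℝ, 0 ≤ E₀ ∧ UniformFormat S M m Uc coords χ W Φ ι wrap emb πc γ₀ E₀ κ := by
  obtain ⟨σ, ρ, Ē, hσ, -, hρ1, hcl, hZ, hL⟩ := h
  exact ⟨σ / (1 - ρ), div_nonneg hσ.le (by linarith), uniformFormat_of_split S M m Uc coords χ W Φ Φz ι wrap emb πc hσ hρ1 hcl hZ hL⟩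

/-- What the wall DOES give toward (L), for the record (the absorption price): wall `E₀` and (Z) `σ` bound the difference by `E₀ + σ`
— an ADDITIVE constant, which (L) has no slot for.  (This is why gen 0's free-`σ₀` step was wall-inhabited and (L) is not: §3 Toy A.) -/
theorem dChannel_of_wall {γ₀ E₀ σ κ : ℝ} (hW : UniformFormat S M m Uc coords χ W Φ ι wrap emb πc γ₀ E₀ κ)
    (hZ : ZeroInputFormat S M m Uc coords χ W Φz ι wrap emb πc γ₀ σ κ) :
    ∀ k v, v ∈ FlowStep.Box γ₀ k →
      FormatPlus (S k) (M k) (Uc k) (coords k) (m k) (χ k) (fun n B => Φ k v n B - Φz k v n B) (ι k) (wrap k) (emb k)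
        (πc k) (E₀ + σ) κ :=
  fun k v hv => formatPlus_sub (hW k v hv) (hZ k v hv)

end Glue

/-! ## §3. Models inside the mould: the wall does not inhabit the split; (L) and (Z) are not the wall; the split fires -/

section Toys

/-- One localization domain of tree length `0`. -/
abbrev toyS : ℕ → LocDomainSys := fun _ => { Dom := Unit, dj := fun _ => 0, dj_nonneg := fun _ => le_rfl }

/-- No coordinates. -/
abbrev toyM : ℕ → ℕ := fun _ => 0

/-- The whole (empty-dimensional) coordinate space. -/
abbrev toyUc : (n : ℕ) → (toyS n).Dom → Set (Fin (toyM n) → ℂ) := fun _ _ => Set.univ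

/-- No coordinates «in X». -/
abbrev toyCoords : (n : ℕ) → (toyS n).Dom → Finset (Fin (toyM n)) := fun _ _ => ∅

/-- Chart dimension `0`. -/
abbrev toym : ℕ → ℕ := fun _ => 0

/-- The identity chart on the empty coordinate space. -/
abbrev toyχ : (n : ℕ) → (toyS n).Dom → (Fin (toym n) → ℂ) → (Fin (toyM n) → ℂ) := fun _ _ u => u

/-- The field variable `B : ℂ` is sent to the empty coordinate vector. -/
abbrev toyι : (n : ℕ) → ℂ → (Fin (toym n) → ℂ) := fun _ _ => ![]

/-- No wrapping domains. -/
abbrev toyWrap : (n : ℕ) → Finset (toyS n).Dom := fun _ => ∅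

/-- Identity domain embedding. -/
abbrev toyEmb : (n : ℕ) → (toyS n).Dom → (toyS (n + 1)).Dom := fun _ X => X

/-- Identity coordinate projection. -/
abbrev toyπc : (n : ℕ) → (toyS n).Dom → (Fin (toyM (n + 1)) → ℂ) → (Fin (toyM n) → ℂ) := fun _ _ u => u

/-- The constant functional with value `c` at every member. -/
abbrev constFun (c : ℝ) : (n : ℕ) → ℂ → ℂ := fun _ _ => (c : ℂ)

/-- **The mould on the toy data is exactly `|c| ≤ E₀`** for the constant functional `c` (any `κ`: tree length `0`). -/
theorem toy_formatPlus_iff (c E₀ κ : ℝ) :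
    FormatPlus toyS toyM toyUc toyCoords toym toyχ (W := fun _ => ℂ) (constFun c) toyι toyWrap toyEmb toyπc E₀ κ ↔
      |c| ≤ E₀ := by
  constructor
  · rintro ⟨P, -, hB, -, hR, -⟩
    have h0 := (hR 0).self_of_nhds
    rw [Fintype.sum_unique] at h0
    have h2 := hB 0 default (toyχ 0 default (toyι 0 0)) (Set.mem_univ _)
    rw [← h0] at h2
    simpa using h2
  · intro hc
    refine ⟨fun _ _ _ => (c : ℂ), ?_, ?_, ?_, ?_, ?_⟩
    · intro n X
      exact analyticOnNhd_const
    · intro n X u _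
      simpa using hc
    · intro n X u u' _
      rfl
    · intro n
      exact Filter.Eventually.of_forall fun B => by simp
    · intro n X _ u'
      rfl

/-- Level-indexed toy data (the same at every level) and level functionals given by real sequences. -/
abbrev lvS : ℕ → ℕ → LocDomainSys := fun _ => toyS
/-- idem -/
abbrev lvM : ℕ → ℕ → ℕ := fun _ => toyM
/-- idem -/
abbrev lvm : ℕ → ℕ → ℕ := fun _ => toym
/-- idem -/
abbrev lvUc : (k n : ℕ) → (lvS k n).Dom → Set (Fin (lvM k n) → ℂ) := fun _ => toyUc
/-- idem -/
abbrev lvCoords : (k n : ℕ) → (lvS k n).Dom → Finset (Fin (lvM k n)) := fun _ => toyCoords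
/-- idem -/
abbrev lvχ : (k n : ℕ) → (lvS k n).Dom → (Fin (lvm k n) → ℂ) → (Fin (lvM k n) → ℂ) := fun _ => toyχ
/-- idem -/
abbrev lvW : ℕ → ℕ → Type := fun _ _ => ℂ
/-- idem -/
abbrev lvι : (k n : ℕ) → lvW k n → (Fin (lvm k n) → ℂ) := fun _ => toyι
/-- idem -/
abbrev lvWrap : (k n : ℕ) → Finset (lvS k n).Dom := fun _ => toyWrap
/-- idem -/
abbrev lvEmb : (k n : ℕ) → (lvS k n).Dom → (lvS k (n + 1)).Dom := fun _ => toyEmb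
/-- idem -/
abbrev lvπc : (k n : ℕ) → (lvS k n).Dom → (Fin (lvM k (n + 1)) → ℂ) → (Fin (lvM k n) → ℂ) := fun _ => toyπc

/-- The level functional with value `N k` at level `k` (every history, every member). -/
abbrev seqFun (N : ℕ → ℝ) : (k : ℕ) → (Fin (k + 1) → ℝ) → (n : ℕ) → lvW k n → ℂ := fun k _ _ _ => (N k : ℂ)

/-- The mould at level `k` on the toy data for the sequence functional is `|N k| ≤ E`. -/
theorem lv_formatPlus_iff (N : ℕ → ℝ) (k : ℕ) (v : Fin (k + 1) → ℝ) (E κ : ℝ) :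
    FormatPlus (lvS k) (lvM k) (lvUc k) (lvCoords k) (lvm k) (lvχ k) (seqFun N k v) (lvι k) (lvWrap k) (lvEmb k) (lvπc k)
        E κ ↔ |N k| ≤ E :=
  toy_formatPlus_iff (N k) E κ

/-- The DIFFERENCE of two sequence functionals is the sequence functional of the difference. -/
theorem lv_sub_eq (N Z : ℕ → ℝ) (k : ℕ) (v : Fin (k + 1) → ℝ) :
    (fun n B => seqFun N k v n B - seqFun Z k v n B) = seqFun (fun j => N j - Z j) k v := by
  funext n B
  simp

/-- A constant admissible history: `Box γ₀ k` is nonempty for `γ₀ > 0`. -/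
theorem const_mem_box {γ₀ : ℝ} (hγ : 0 < γ₀) (k : ℕ) : (fun _ => γ₀ : Fin (k + 1) → ℝ) ∈ FlowStep.Box γ₀ k := by
  intro i _
  exact Set.mem_Ioc.2 ⟨hγ, le_rfl⟩

/-! ### Toy A: the wall holds, (Z) holds, the split item FAILS — the wall does not inhabit the split -/

/-- Total sizes: `1` at level `0`, `2` from level `1` on. -/
def NA : ℕ → ℝ := fun k => if k = 0 then 1 else 2
/-- Zero-input sizes: `1` at every level. -/
def ZA : ℕ → ℝ := fun _ => 1

theorem toyA_wall (γ₀ κ : ℝ) :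
    UniformFormat lvS lvM lvm lvUc lvCoords lvχ lvW (seqFun NA) lvι lvWrap lvEmb lvπc γ₀ 2 κ := by
  intro k v _
  rw [lv_formatPlus_iff]
  unfold NA
  split_ifs <;> norm_num

theorem toyA_zeroInput (γ₀ κ : ℝ) :
    ZeroInputFormat lvS lvM lvm lvUc lvCoords lvχ lvW (seqFun ZA) lvι lvWrap lvEmb lvπc γ₀ 1 κ := by
  intro k v _
  rw [lv_formatPlus_iff]
  simp [ZA]

/-- (L) fails on Toy A for EVERY `ρ < 1` as soon as `Ē ≥ 1` (which the closure forces, (Z) pinning `σ ≥ 1`). -/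
theorem toyA_not_contraction {γ₀ κ ρ Ē : ℝ} (hγ : 0 < γ₀) (hρ1 : ρ < 1) (hĒ : 1 ≤ Ē) :
    ¬ DChannelContraction lvS lvM lvm lvUc lvCoords lvχ lvW (seqFun NA) (seqFun ZA) lvι lvWrap lvEmb lvπc γ₀ ρ Ē κ := by
  intro hL
  have h := hL 1 (fun _ => γ₀) (const_mem_box hγ 1) 1 zero_lt_one hĒ (by
    intro j hj w _
    have hj0 : j = 0 := by omega
    subst hj0
    rw [lv_formatPlus_iff]
    simp [NA])
  rw [lv_sub_eq, lv_formatPlus_iff] at h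
  have h1 : (1 : ℝ) ≤ ρ := by norm_num [NA, ZA] at h; exact h
  linarith

/-- **Toy A verdict**: the split item is FALSE on a model where the wall (and (Z)) hold. -/
theorem toyA_not_splitItem {γ₀ κ : ℝ} (hγ : 0 < γ₀) :
    ¬ SplitItem lvS lvM lvm lvUc lvCoords lvχ lvW (seqFun NA) (seqFun ZA) lvι lvWrap lvEmb lvπc γ₀ κ := by
  rintro ⟨σ, ρ, Ē, _, hρ, hρ1, hcl, hZ, hL⟩
  have hσ1 : 1 ≤ σ := by
    have h := hZ 0 (fun _ => γ₀) (const_mem_box hγ 0)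
    rw [lv_formatPlus_iff] at h
    simpa [ZA] using h
  have h1 : 1 ≤ (1 - ρ) * Ē := hσ1.trans hcl
  have hĒ : 1 ≤ Ē := by nlinarith
  exact toyA_not_contraction hγ hρ1 hĒ hL

/-! ### Toy B: (L) holds (ρ = 0) while the wall fails; Toy B′: (Z) holds while the wall fails -/

/-- Sizes `k` at level `k` (total = zero-input; the history channel vanishes). -/
def NB : ℕ → ℝ := fun k => k

theorem toyB_contraction (γ₀ Ē κ : ℝ) :
    DChannelContraction lvS lvM lvm lvUc lvCoords lvχ lvW (seqFun NB) (seqFun NB) lvι lvWrap lvEmb lvπc γ₀ 0 Ē κ := by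
  intro k v _ E _ _ _
  rw [lv_sub_eq, lv_formatPlus_iff]
  simp

theorem toyB_not_wall {γ₀ κ : ℝ} (hγ : 0 < γ₀) (E₀ : ℝ) :
    ¬ UniformFormat lvS lvM lvm lvUc lvCoords lvχ lvW (seqFun NB) lvι lvWrap lvEmb lvπc γ₀ E₀ κ := by
  intro hW
  obtain ⟨K, hK⟩ := exists_nat_gt E₀
  have h := hW K (fun _ => γ₀) (const_mem_box hγ K)
  rw [lv_formatPlus_iff] at h
  simp [NB] at h
  linarith

/-- Toy B′: zero-input sizes `0`, total sizes `k`: (Z) holds with `σ = 0`, the wall fails (by `toyB_not_wall`). -/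
theorem toyB'_zeroInput (γ₀ κ : ℝ) :
    ZeroInputFormat lvS lvM lvm lvUc lvCoords lvχ lvW (seqFun fun _ => 0) lvι lvWrap lvEmb lvπc γ₀ 0 κ := by
  intro k v _
  rw [lv_formatPlus_iff]
  simp

/-! ### Toy C: (Z), (L) and the closure hold non-vacuously; the glue fires (rule (N) witness) -/

/-- Total sizes: `1` at level `0`, `3/2` from level `1` on; zero-input sizes `1`; history channel `0` then `1/2`. -/
def NC : ℕ → ℝ := fun k => if k = 0 then 1 else 3 / 2
/-- idem -/
def ZC : ℕ → ℝ := fun _ => 1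

theorem toyC_zeroInput (γ₀ κ : ℝ) :
    ZeroInputFormat lvS lvM lvm lvUc lvCoords lvχ lvW (seqFun ZC) lvι lvWrap lvEmb lvπc γ₀ 1 κ := by
  intro k v _
  rw [lv_formatPlus_iff]
  simp [ZC]

/-- (L) on Toy C with `ρ = 1/2`, `Ē = 2`: at level `0` the channel is `0`; from level `1` on the hypothesis at level `0` forces `E ≥ 1`. -/
theorem toyC_contraction {γ₀ : ℝ} (hγ : 0 < γ₀) (κ : ℝ) :
    DChannelContraction lvS lvM lvm lvUc lvCoords lvχ lvW (seqFun NC) (seqFun ZC) lvι lvWrap lvEmb lvπc γ₀ (1 / 2) 2 κ := by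
  intro k v _ E hE _ hhist
  rw [lv_sub_eq, lv_formatPlus_iff]
  show |NC k - ZC k| ≤ 1 / 2 * E
  by_cases hk : k = 0
  · subst hk
    have h0 : |NC 0 - ZC 0| = 0 := by norm_num [NC, ZC]
    rw [h0]
    exact mul_nonneg (by norm_num) hE.le
  · have h0 := hhist 0 (Nat.pos_of_ne_zero hk) (fun _ => γ₀) (const_mem_box hγ 0)
    rw [lv_formatPlus_iff] at h0
    have h1 : (1 : ℝ) ≤ E := by simpa [NC] using h0
    have h2 : NC k - ZC k = 1 / 2 := by norm_num [NC, ZC, hk]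
    rw [h2, abs_of_pos (by norm_num : (0 : ℝ) < 1 / 2)]
    linarith

/-- **Toy C verdict**: the split item HOLDS (σ = 1, ρ = 1/2, Ē = 2, closure `1 ≤ (1/2)·2`). -/
theorem toyC_splitItem {γ₀ : ℝ} (hγ : 0 < γ₀) (κ : ℝ) :
    SplitItem lvS lvM lvm lvUc lvCoords lvχ lvW (seqFun NC) (seqFun ZC) lvι lvWrap lvEmb lvπc γ₀ κ :=
  ⟨1, 1 / 2, 2, zero_lt_one, by norm_num, by norm_num, by norm_num, toyC_zeroInput γ₀ κ, toyC_contraction hγ κ⟩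

/-- … and the glue fires: the wall with `E₀ = 1 ∕ (1 − 1/2) = 2` (true: the sizes are `≤ 3/2`). -/
theorem toyC_wall {γ₀ : ℝ} (hγ : 0 < γ₀) (κ : ℝ) :
    ∃ E₀ : ℝ, 0 ≤ E₀ ∧ UniformFormat lvS lvM lvm lvUc lvCoords lvχ lvW (seqFun NC) lvι lvWrap lvEmb lvπc γ₀ E₀ κ :=
  wall_of_splitItem _ _ _ _ _ _ _ _ _ _ _ _ _ (toyC_splitItem hγ κ)

end Toys

end

/-! ## §5. (L) ⟸ UNIFORM BOUND AT ONE FIXED INPUT SCALE + SCHWARZ IN THE HISTORY-SCALING PARAMETER (gen-4 addendum 21:50Z)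

The contraction constant of lens (ii) as a Cauchy bound: if the pieces of the history-response `R(A⁰ + z·h) − R(A⁰)` extend
analytically in the scalar `z` to the disc `|z| < R` (`R := Ē′/E` for a history of format `E`), are bounded there in the (1.18) row
by a constant `C` (= Theorem 3's step at the ONE fixed input scale `Ē′`, print's envelope p.19 L4–6 intact), and vanish at `z = 0`
(no history ⇒ no response: `dChannel_zero…`), then at `z = 1` the (1.18) row holds with constant `C / R = (C/Ē′)·E` — LINEAR in `E`
with the E-free `ρ := C/Ē′`, by the Schwarz lemma (Mathlib `Complex.dist_le_div_mul_dist_of_mapsTo_ball`).  Print's «C₃ linear in E₀»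
([II] p.20 L28–31) is the shadow of `f(0) = 0` + maximum modulus; no re-counting of [II] (2.31)–(2.35) with two rates is needed. -/

/-- **Schwarz ⇒ the (1.18) row contracts linearly in the history scale.**  A `z`-family of piece systems, analytic in `z` on the
disc of radius `R > 1` at every admissible coordinate point, uniformly (1.18)-bounded by `C` there and vanishing at `z = 0`, is
(1.18)-bounded by `C / R` at `z = 1`. [cite: Balaban1988RG2Cluster, Lemma 3 (2.38) p.20 with C₃ ∝ E₀ (mechanism); Mathlib Schwarz lemma] -/
theorem bound118_of_schwarz {S : ℕ → LocDomainSys} {M : ℕ → ℕ} (Uc : (n : ℕ) → (S n).Dom → Set (Fin (M n) → ℂ))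
    (Ez : ℂ → Pieces S M) {R C κ : ℝ} (hR : 1 < R)
    (hd : ∀ n X u, u ∈ Uc n X → DifferentiableOn ℂ (fun z => Ez z n X u) (Metric.ball 0 R))
    (hb : ∀ z ∈ Metric.ball (0 : ℂ) R, Bound118 S Uc (Ez z) C κ)
    (h0 : ∀ n X u, u ∈ Uc n X → Ez 0 n X u = 0) :
    Bound118 S Uc (Ez 1) (C / R) κ := by
  intro n X u hu
  have h1 : (1 : ℂ) ∈ Metric.ball (0 : ℂ) R := by
    rw [Metric.mem_ball, dist_zero_right, norm_one]; exact hR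
  have hmaps : Set.MapsTo (fun z => Ez z n X u) (Metric.ball 0 R)
      (Metric.closedBall ((fun z => Ez z n X u) 0) (C * Real.exp (-κ * (S n).dj X))) := by
    intro z hz
    show dist (Ez z n X u) (Ez 0 n X u) ≤ C * Real.exp (-κ * (S n).dj X)
    rw [h0 n X u hu, dist_zero_right]
    exact hb z hz n X u hu
  have hS := Complex.dist_le_div_mul_dist_of_mapsTo_ball (hd n X u hu) hmaps h1
  have hS' : dist (Ez 1 n X u) (Ez 0 n X u) ≤ C * Real.exp (-κ * (S n).dj X) / R * dist (1 : ℂ) 0 := hS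
  rw [h0 n X u hu, dist_zero_right, dist_zero_right, norm_one, mul_one] at hS'
  calc ‖Ez 1 n X u‖ ≤ C * Real.exp (-κ * (S n).dj X) / R := hS'
    _ = C / R * Real.exp (-κ * (S n).dj X) := by ring

/-- The same with the history scale displayed: radius `R := Ē′ / E` for a history of format `0 < E < Ē′` gives the (1.18) row with
constant `(C / Ē′) * E` — i.e. (L)'s `ρ · E` with `ρ := C / Ē′` independent of `E`. [cite: Balaban1988RG2Cluster, (2.38)–(2.41) pp.20–21 (mechanism)] -/
theorem bound118_linear_in_scale {S : ℕ → LocDomainSys} {M : ℕ → ℕ} (Uc : (n : ℕ) → (S n).Dom → Set (Fin (M n) → ℂ))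
    (Ez : ℂ → Pieces S M) {E Ē' C κ : ℝ} (hE : 0 < E) (hEĒ : E < Ē')
    (hd : ∀ n X u, u ∈ Uc n X → DifferentiableOn ℂ (fun z => Ez z n X u) (Metric.ball 0 (Ē' / E)))
    (hb : ∀ z ∈ Metric.ball (0 : ℂ) (Ē' / E), Bound118 S Uc (Ez z) C κ)
    (h0 : ∀ n X u, u ∈ Uc n X → Ez 0 n X u = 0) :
    Bound118 S Uc (Ez 1) (C / Ē' * E) κ := by
  have hR : 1 < Ē' / E := by rw [lt_div_iff₀ hE]; linarith
  have h := bound118_of_schwarz Uc Ez hR hd hb h0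
  have hEq : C / (Ē' / E) = C / Ē' * E := by
    field_simp
  rwa [hEq] at h

/-- **(L) ⟸ (L♭) + Schwarz, at the `FormatPlus` level.**  If the response pieces at `z = 1` carry the four non-(1.18) rows
(analyticity, (1.17) locality, representation of `Φ` near 0, volume-independence — Theorem 3's output at the one fixed scale `Ē′`)
and the `z`-family satisfies the Schwarz hypotheses, then `Φ` is in the format with the LINEAR constant `(C / Ē′) * E`.
[cite: Balaban1988RG2Cluster, Theorem 3 step at fixed input scale + (1.22)–(1.23) p.7 (analytic extension in an auxiliary parameter)] -/
theorem formatPlus_of_schwarz {S : ℕ → LocDomainSys} {M : ℕ → ℕ} (Uc : (n : ℕ) → (S n).Dom → Set (Fin (M n) → ℂ))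
    (coords : (n : ℕ) → (S n).Dom → Finset (Fin (M n))) (m : ℕ → ℕ)
    (χ : (n : ℕ) → (S n).Dom → (Fin (m n) → ℂ) → (Fin (M n) → ℂ)) {W : ℕ → Type*} [∀ n, TopologicalSpace (W n)]
    [∀ n, Zero (W n)] (Φf : (n : ℕ) → W n → ℂ) (ι : (n : ℕ) → W n → (Fin (m n) → ℂ))
    (wrap : (n : ℕ) → Finset (S n).Dom) (emb : (n : ℕ) → (S n).Dom → (S (n + 1)).Dom)
    (πc : (n : ℕ) → (S n).Dom → (Fin (M (n + 1)) → ℂ) → (Fin (M n) → ℂ))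
    (Ez : ℂ → Pieces S M) {E Ē' C κ : ℝ} (hE : 0 < E) (hEĒ : E < Ē')
    (hA : Analytic19 Uc (Ez 1)) (hL : Local17 coords (Ez 1)) (hR : Repr17 S (Ez 1) χ Φf ι)
    (hV : PieceVolIndep S M wrap emb πc (Ez 1))
    (hd : ∀ n X u, u ∈ Uc n X → DifferentiableOn ℂ (fun z => Ez z n X u) (Metric.ball 0 (Ē' / E)))
    (hb : ∀ z ∈ Metric.ball (0 : ℂ) (Ē' / E), Bound118 S Uc (Ez z) C κ)
    (h0 : ∀ n X u, u ∈ Uc n X → Ez 0 n X u = 0) :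
    FormatPlus S M Uc coords m χ Φf ι wrap emb πc (C / Ē' * E) κ :=
  ⟨Ez 1, hA, bound118_linear_in_scale Uc Ez hE hEĒ hd hb h0, hL, hR, hV⟩

end Summit.QuantumFields.YangMills.Cruxes.Record13SepCoPHInhabited.Lens2G4
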